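import Summits.BirchSwinnertonDyer.BirchSwinnertonDyer.Theorems.ByReductionTypeAtTwoFineSelmerConjAAtTwoAdditivePotGoodCapitulationD10120n
import Summits.BirchSwinnertonDyer.BirchSwinnertonDyer.Theorems.ByReductionTypeAtTwoFineSelmerConjAAtTwoAdditivePotGoodCapitulationD115236n
import Summits.BirchSwinnertonDyer.BirchSwinnertonDyer.Theorems.ByReductionTypeAtTwoFineSelmerConjAAtTwoAdditivePotGoodCapitulationD2284n
import Summits.BirchSwinnertonDyer.BirchSwinnertonDyer.Theorems.ByReductionTypeAtTwoFineSelmerConjAAtTwoAdditivePotGoodCapitulationD36763n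
import Summits.BirchSwinnertonDyer.BirchSwinnertonDyer.Theorems.ByReductionTypeAtTwoFineSelmerConjAAtTwoAdditivePotGoodCapitulationD4108n
import Summits.BirchSwinnertonDyer.BirchSwinnertonDyer.Theorems.ByReductionTypeAtTwoFineSelmerConjAAtTwoAdditivePotGoodCapitulationD54167n
import Summits.BirchSwinnertonDyer.BirchSwinnertonDyer.Theorems.ByReductionTypeAtTwoFineSelmerConjAAtTwoAdditivePotGoodFukudaRowStampsE
import Summits.BirchSwinnertonDyer.BirchSwinnertonDyer.Theorems.ByReductionTypeAtTwoFineSelmerConjAAtTwoAdditivePotGoodFukudaRowStampsF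
import HarnessLib

/-!
# Route `ByReductionTypeAtTwo` (rung K4), crux C1″ `FineSelmerConjAAtTwoAdditivePotGood` (item stmt-BirchSwinnertonDyer-22615):
# IWASAWA `μ₂ = 0`, KERNEL, BY NAME, for the cubic point fields of the census rows with TWO primes above `2` or EVEN class number
# and `Δ_cubic < 0` — part C (capitulation rows) (a `--supports 22615` file; seat `bsd-2adic-k4-w1` GEN 8, lane (c) «capitulation/Chevalley rows» of pen RC-472)

HONEST FRAMING (cell `bsd-2adic`, D-0036/D-0054/D-0152): THEOREMS ONLY (no definition, no named fact, no `sorry`); each theorem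
`classicalMu_two_<L>` is PROVED OUTRIGHT: Iwasawa's classical `μ₂` vanishes (growth form `ClassicalMuVanishes`) along every cyclotomic
`ℤ₂`-extension of the cubic field `ℚ(θ)` = the `2`-torsion point field of the census curve `<L>` (an `S₃`-cubic field with `2 = 𝔭²𝔮`,
`2 = 𝔭₁𝔭₂` or even class number — OUTSIDE Iwasawa 1956). These statements were so far BURIED inside `conjA_two_<L> hLim2` (GEN 5–7); they are
the `hμ` input of cruxlead-19573-w2 GEN 7's «Iwasawa ℓ = 2 ascent with real places» to the totally complex `ℚ(E[2]) = ℚ(θ, √Δ)` (Δ < 0 on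
every row here), after which w2's kernel Lim 3.5@2 (p723148) yields (A)₂ for these rows WITHOUT `hLim2`. This file closes nothing at the
`∀`-level; nothing booked; it is number theory about cubic fields — BSD is not proved by any of this.

MECHANISM (all kernel, GEN 5–7 by name): Chevalley rows — `layerOneBit_of_chevalleyCert` (`e₁ = 0` from a `2`-adically certified non-norm
unit, ≤ 2 primes above `2`) + `classicalMuVanishes_two_adjoin_of_evenIndexCertificate` (`n₀ = 0` by the even-index certificate, Fukuda
Thm. 1 (1)); capitulation rows — `classNumberPExp_one_eq_zero_layer_d…` (`e₁ = e₀` by the capitulation certificate) +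
`forall_totallyRamifiedFrom_zero_adjoin_of_…` + `classicalMuVanishes_of_classNumberPExp_succ_eq fukuda1994_…_holds`.
Rows here: `194140b1` (d = -2284) · `98592q1` (d = -4108) · `433336a1` (d = -54167) · `294104f1` (d = -36763) · `121440bf1` (d = -10120) · `460944bn1` (d = -115236).

References: [Fukuda1994] Thm. 1 (1); [Lang1990] Ch. 13 §4; [Greenberg2001IwasawaPastPresent] Prop. 2.1, §4; [Washington1997] §13.
-/

set_option autoImplicit false
-- sibling precedent (`…GenusDoorCubic.lean`): the directory name repeats the summit name
set_option linter.dupNamespace false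

noncomputable section

open scoped Classical IntermediateField NumberField

namespace Summit.BirchSwinnertonDyer.BirchSwinnertonDyer.Theorems.AddKatoTwo

open WeierstrassCurve Field Polynomial IsDedekindDomain NumberField Matrix Literature.NumberTheory.EllipticCurves
  Literature.NumberTheory.GaloisRepresentations
  Literature.NumberTheory.IwasawaTheory
  Summit.BirchSwinnertonDyer.BirchSwinnertonDyer.Theorems.AlignedTransportAtTwoTorsionPointField
  Summit.BirchSwinnertonDyer.BirchSwinnertonDyer.Theses.ByReductionTypeAtTwo

/-- **Iwasawa's `μ₂ = 0` for the cubic field of the census row `194140b1` (`d = -2284`), KERNEL — every cyclotomic `ℤ₂`-extension of `ℚ(θ)`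
has `μ = 0` (growth form).** The `hμ`-core of `conjA_two_194140b1 hLim2` exposed by name: `n₀ = 0` (kernel) + the capitulation certificate
`classNumberPExp_one_eq_zero_layer_d2284n` (`e₁ = e₀`) + Fukuda 1994 Thm. 1 (1); NO Lim fact, no displayed datum. Input of cruxlead-19573-w2's ℓ = 2 ascent to `ℚ(E[2])`
(Δ < 0). [cite: Fukuda1994, Thm. 1 (1), p. 264] [cite: Greenberg2001IwasawaPastPresent, §4 (Iwasawa's μ-conjecture)] -/
theorem classicalMu_two_194140b1 {θ : AlgebraicClosure ℚ} (hθ : aeval θ (Cubic.toPoly ⟨1, ((-2 : ℤ) : ℚ), ((-16 : ℤ) : ℚ), ((-18 : ℤ) : ℚ)⟩) = 0) :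
    haveI : FiniteDimensional ℚ (IntermediateField.adjoin ℚ {θ}) :=
      IntermediateField.adjoin.finiteDimensional ((AlgebraicClosure.isAlgebraic ℚ).isAlgebraic θ).isIntegral
    haveI : NumberField (IntermediateField.adjoin ℚ {θ}) := NumberField.mk
    ∀ κL : ZpExtension (IntermediateField.adjoin ℚ {θ}) 2, κL.IsCyclotomic → ClassicalMuVanishes κL := by
  haveI : FiniteDimensional ℚ (IntermediateField.adjoin ℚ {θ}) :=
    IntermediateField.adjoin.finiteDimensional ((AlgebraicClosure.isAlgebraic ℚ).isAlgebraic θ).isIntegral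
  haveI : NumberField (IntermediateField.adjoin ℚ {θ}) := NumberField.mk
  intro κL hκL
  have hirr := irreducible_cubic_d2284n
  exact classicalMuVanishes_of_classNumberPExp_succ_eq fukuda1994_thm1_classNumberPExp_const_of_succ_eq_holds κL
    ((forall_totallyRamifiedFrom_zero_adjoin_of_existsUnique_two_mem (p := -2) (q := -16) (r := -18) hirr hθ
      (existsUnique_two_mem_adjoin_of_eisenstein (p := -2) (q := -16) (r := -18) (by decide) (by decide) (by decide) (by decide) hθ)) κL hκL) le_rfl (classNumberPExp_one_eq_zero_layer_d2284n hθ κL hκL)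

/-- **Iwasawa's `μ₂ = 0` for the cubic field of the census row `98592q1` (`d = -4108`), KERNEL — every cyclotomic `ℤ₂`-extension of `ℚ(θ)`
has `μ = 0` (growth form).** The `hμ`-core of `conjA_two_98592q1 hLim2` exposed by name: `n₀ = 0` (kernel) + the capitulation certificate
`classNumberPExp_one_eq_zero_layer_d4108n` (`e₁ = e₀`) + Fukuda 1994 Thm. 1 (1); NO Lim fact, no displayed datum. Input of cruxlead-19573-w2's ℓ = 2 ascent to `ℚ(E[2])`
(Δ < 0). [cite: Fukuda1994, Thm. 1 (1), p. 264] [cite: Greenberg2001IwasawaPastPresent, §4 (Iwasawa's μ-conjecture)] -/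
theorem classicalMu_two_98592q1 {θ : AlgebraicClosure ℚ} (hθ : aeval θ (Cubic.toPoly ⟨1, ((0 : ℤ) : ℚ), ((10 : ℤ) : ℚ), ((-2 : ℤ) : ℚ)⟩) = 0) :
    haveI : FiniteDimensional ℚ (IntermediateField.adjoin ℚ {θ}) :=
      IntermediateField.adjoin.finiteDimensional ((AlgebraicClosure.isAlgebraic ℚ).isAlgebraic θ).isIntegral
    haveI : NumberField (IntermediateField.adjoin ℚ {θ}) := NumberField.mk
    ∀ κL : ZpExtension (IntermediateField.adjoin ℚ {θ}) 2, κL.IsCyclotomic → ClassicalMuVanishes κL := by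
  haveI : FiniteDimensional ℚ (IntermediateField.adjoin ℚ {θ}) :=
    IntermediateField.adjoin.finiteDimensional ((AlgebraicClosure.isAlgebraic ℚ).isAlgebraic θ).isIntegral
  haveI : NumberField (IntermediateField.adjoin ℚ {θ}) := NumberField.mk
  intro κL hκL
  have hirr := irreducible_cubic_d4108n
  exact classicalMuVanishes_of_classNumberPExp_succ_eq fukuda1994_thm1_classNumberPExp_const_of_succ_eq_holds κL
    ((forall_totallyRamifiedFrom_zero_adjoin_of_existsUnique_two_mem (p := 0) (q := 10) (r := -2) hirr hθ
      (existsUnique_two_mem_adjoin_of_eisenstein (p := 0) (q := 10) (r := -2) (by decide) (by decide) (by decide) (by decide) hθ)) κL hκL) le_rfl (classNumberPExp_one_eq_zero_layer_d4108n hθ κL hκL)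

/-- **Iwasawa's `μ₂ = 0` for the cubic field of the census row `433336a1` (`d = -54167`), KERNEL — every cyclotomic `ℤ₂`-extension of `ℚ(θ)`
has `μ = 0` (growth form).** The `hμ`-core of `conjA_two_433336a1 hLim2` exposed by name: `n₀ = 0` (kernel) + the capitulation certificate
`classNumberPExp_one_eq_zero_layer_d54167n` (`e₁ = e₀`) + Fukuda 1994 Thm. 1 (1); NO Lim fact, no displayed datum. Input of cruxlead-19573-w2's ℓ = 2 ascent to `ℚ(E[2])`
(Δ < 0). [cite: Fukuda1994, Thm. 1 (1), p. 264] [cite: Greenberg2001IwasawaPastPresent, §4 (Iwasawa's μ-conjecture)] -/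
theorem classicalMu_two_433336a1 {θ : AlgebraicClosure ℚ} (hθ : aeval θ (Cubic.toPoly ⟨1, ((-1 : ℤ) : ℚ), ((-38 : ℤ) : ℚ), ((-89 : ℤ) : ℚ)⟩) = 0) :
    haveI : FiniteDimensional ℚ (IntermediateField.adjoin ℚ {θ}) :=
      IntermediateField.adjoin.finiteDimensional ((AlgebraicClosure.isAlgebraic ℚ).isAlgebraic θ).isIntegral
    haveI : NumberField (IntermediateField.adjoin ℚ {θ}) := NumberField.mk
    ∀ κL : ZpExtension (IntermediateField.adjoin ℚ {θ}) 2, κL.IsCyclotomic → ClassicalMuVanishes κL := by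
  haveI : FiniteDimensional ℚ (IntermediateField.adjoin ℚ {θ}) :=
    IntermediateField.adjoin.finiteDimensional ((AlgebraicClosure.isAlgebraic ℚ).isAlgebraic θ).isIntegral
  haveI : NumberField (IntermediateField.adjoin ℚ {θ}) := NumberField.mk
  intro κL hκL
  have hirr := irreducible_cubic_d54167n
  exact classicalMuVanishes_of_classNumberPExp_succ_eq fukuda1994_thm1_classNumberPExp_const_of_succ_eq_holds κL
    ((forall_totallyRamifiedFrom_zero_adjoin_of_existsUnique_two_mem (p := -1) (q := -38) (r := -89) hirr hθ
      (existsUnique_two_mem_adjoin_of_odd (p := -1) (q := -38) (r := -89) (by decide) (by decide) hθ)) κL hκL) le_rfl (classNumberPExp_one_eq_zero_layer_d54167n hθ κL hκL)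

/-- **Iwasawa's `μ₂ = 0` for the cubic field of the census row `294104f1` (`d = -36763`), KERNEL — every cyclotomic `ℤ₂`-extension of `ℚ(θ)`
has `μ = 0` (growth form).** The `hμ`-core of `conjA_two_294104f1 hLim2` exposed by name: `n₀ = 0` (kernel) + the capitulation certificate
`classNumberPExp_one_eq_zero_layer_d36763n` (`e₁ = e₀`) + Fukuda 1994 Thm. 1 (1); NO Lim fact, no displayed datum. Input of cruxlead-19573-w2's ℓ = 2 ascent to `ℚ(E[2])`
(Δ < 0). [cite: Fukuda1994, Thm. 1 (1), p. 264] [cite: Greenberg2001IwasawaPastPresent, §4 (Iwasawa's μ-conjecture)] -/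
theorem classicalMu_two_294104f1 {θ : AlgebraicClosure ℚ} (hθ : aeval θ (Cubic.toPoly ⟨1, ((-1 : ℤ) : ℚ), ((-59 : ℤ) : ℚ), ((-160 : ℤ) : ℚ)⟩) = 0) :
    haveI : FiniteDimensional ℚ (IntermediateField.adjoin ℚ {θ}) :=
      IntermediateField.adjoin.finiteDimensional ((AlgebraicClosure.isAlgebraic ℚ).isAlgebraic θ).isIntegral
    haveI : NumberField (IntermediateField.adjoin ℚ {θ}) := NumberField.mk
    ∀ κL : ZpExtension (IntermediateField.adjoin ℚ {θ}) 2, κL.IsCyclotomic → ClassicalMuVanishes κL := by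
  haveI : FiniteDimensional ℚ (IntermediateField.adjoin ℚ {θ}) :=
    IntermediateField.adjoin.finiteDimensional ((AlgebraicClosure.isAlgebraic ℚ).isAlgebraic θ).isIntegral
  haveI : NumberField (IntermediateField.adjoin ℚ {θ}) := NumberField.mk
  intro κL hκL
  have hirr := irreducible_cubic_d36763n
  exact classicalMuVanishes_of_classNumberPExp_succ_eq fukuda1994_thm1_classNumberPExp_const_of_succ_eq_holds κL
    ((forall_totallyRamifiedFrom_zero_adjoin_of_odd_cubic_discr (p := -1) (q := -59) (r := -160) hirr
      (by simp only [Cubic.discr]; norm_num) hθ) κL hκL) le_rfl (classNumberPExp_one_eq_zero_layer_d36763n hθ κL hκL)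

/-- **Iwasawa's `μ₂ = 0` for the cubic field of the census row `121440bf1` (`d = -10120`), KERNEL — every cyclotomic `ℤ₂`-extension of `ℚ(θ)`
has `μ = 0` (growth form).** The `hμ`-core of `conjA_two_121440bf1 hLim2` exposed by name: `n₀ = 0` (kernel) + the capitulation certificate
`classNumberPExp_one_eq_zero_layer_d10120n` (`e₁ = e₀`) + Fukuda 1994 Thm. 1 (1); NO Lim fact, no displayed datum. Input of cruxlead-19573-w2's ℓ = 2 ascent to `ℚ(E[2])`
(Δ < 0). [cite: Fukuda1994, Thm. 1 (1), p. 264] [cite: Greenberg2001IwasawaPastPresent, §4 (Iwasawa's μ-conjecture)] -/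
theorem classicalMu_two_121440bf1 {θ : AlgebraicClosure ℚ} (hθ : aeval θ (Cubic.toPoly ⟨1, ((-3 : ℤ) : ℚ), ((10 : ℤ) : ℚ), ((10 : ℤ) : ℚ)⟩) = 0) :
    haveI : FiniteDimensional ℚ (IntermediateField.adjoin ℚ {θ}) :=
      IntermediateField.adjoin.finiteDimensional ((AlgebraicClosure.isAlgebraic ℚ).isAlgebraic θ).isIntegral
    haveI : NumberField (IntermediateField.adjoin ℚ {θ}) := NumberField.mk
    ∀ κL : ZpExtension (IntermediateField.adjoin ℚ {θ}) 2, κL.IsCyclotomic → ClassicalMuVanishes κL := by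
  haveI : FiniteDimensional ℚ (IntermediateField.adjoin ℚ {θ}) :=
    IntermediateField.adjoin.finiteDimensional ((AlgebraicClosure.isAlgebraic ℚ).isAlgebraic θ).isIntegral
  haveI : NumberField (IntermediateField.adjoin ℚ {θ}) := NumberField.mk
  intro κL hκL
  have hirr := irreducible_cubic_d10120n
  obtain ⟨B, -, hB⟩ := exists_ringOfIntegers_cubic_root (p := -3) (q := 10) (r := 10) hθ
  have h3 := finrank_adjoin_eq_three_of_irreducible hirr hθ
  have hz : (2 : 𝓞 (IntermediateField.adjoin ℚ {θ})) - (((-63 : ℤ) : 𝓞 (IntermediateField.adjoin ℚ {θ})) + ((-60 : ℤ) : 𝓞 (IntermediateField.adjoin ℚ {θ})) * B + ((29 : ℤ) : 𝓞 (IntermediateField.adjoin ℚ {θ})) * B ^ 2) ^ 3 =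
      ((321309 : ℤ) : 𝓞 (IntermediateField.adjoin ℚ {θ})) + (-2457100 : ℤ) * B + (-3711191 : ℤ) * B ^ 2 := by
    push_cast; linear_combination (((-7126 : ℤ) : 𝓞 (IntermediateField.adjoin ℚ {θ})) + ((324278 : ℤ) : 𝓞 (IntermediateField.adjoin ℚ {θ})) * B + ((78213 : ℤ) : 𝓞 (IntermediateField.adjoin ℚ {θ})) * B ^ 2 + ((-24389 : ℤ) : 𝓞 (IntermediateField.adjoin ℚ {θ})) * B ^ 3) * hB
  have hN : ¬ (8 : ℤ) ∣ Algebra.norm ℤ ((2 : 𝓞 (IntermediateField.adjoin ℚ {θ})) - (((-63 : ℤ) : 𝓞 (IntermediateField.adjoin ℚ {θ})) + ((-60 : ℤ) : 𝓞 (IntermediateField.adjoin ℚ {θ})) * B + ((29 : ℤ) : 𝓞 (IntermediateField.adjoin ℚ {θ})) * B ^ 2) ^ 3) := by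
    rw [hz]
    exact not_eight_dvd_norm_coords _ h3 B hirr hB (321309) (-2457100) (-3711191) (N := 4174952880273450)
      (by simp only [Matrix.one_fin_three, Matrix.det_fin_three, Matrix.add_apply, Matrix.smul_apply, sq, Matrix.mul_apply,
        Fin.sum_univ_three, Matrix.of_apply, Matrix.cons_val', Matrix.cons_val_zero, Matrix.cons_val_one, Matrix.cons_val_two,
        Matrix.head_cons, Matrix.tail_cons, Matrix.empty_val', Matrix.cons_val_fin_one, smul_eq_mul]; norm_num) (by norm_num)
  exact classicalMuVanishes_of_classNumberPExp_succ_eq fukuda1994_thm1_classNumberPExp_const_of_succ_eq_holds κL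
    ((forall_totallyRamifiedFrom_zero_adjoin_of_evenIndexCertificate (p := -3) (q := 10) (r := 10) hirr hθ
      (((0 : ℤ) : 𝓞 (IntermediateField.adjoin ℚ {θ})) + ((-1 : ℤ) : 𝓞 (IntermediateField.adjoin ℚ {θ})) * B + ((-1 : ℤ) : 𝓞 (IntermediateField.adjoin ℚ {θ})) * B ^ 2) (((-1 : ℤ) : 𝓞 (IntermediateField.adjoin ℚ {θ})) + ((0 : ℤ) : 𝓞 (IntermediateField.adjoin ℚ {θ})) * B + ((-1 : ℤ) : 𝓞 (IntermediateField.adjoin ℚ {θ})) * B ^ 2) (((2 : ℤ) : 𝓞 (IntermediateField.adjoin ℚ {θ})) + ((5 : ℤ) : 𝓞 (IntermediateField.adjoin ℚ {θ})) * B + ((1 : ℤ) : 𝓞 (IntermediateField.adjoin ℚ {θ})) * B ^ 2) (((-63 : ℤ) : 𝓞 (IntermediateField.adjoin ℚ {θ})) + ((-60 : ℤ) : 𝓞 (IntermediateField.adjoin ℚ {θ})) * B + ((29 : ℤ) : 𝓞 (IntermediateField.adjoin ℚ {θ})) * B ^ 2)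
      (by push_cast; linear_combination (((-1 : ℤ) : 𝓞 (IntermediateField.adjoin ℚ {θ})) + ((-1 : ℤ) : 𝓞 (IntermediateField.adjoin ℚ {θ})) * B) * hB) (by push_cast; linear_combination (((13 : ℤ) : 𝓞 (IntermediateField.adjoin ℚ {θ})) + ((1 : ℤ) : 𝓞 (IntermediateField.adjoin ℚ {θ})) * B) * hB) hN) κL hκL) le_rfl (classNumberPExp_one_eq_zero_layer_d10120n hθ κL hκL)

/-- **Iwasawa's `μ₂ = 0` for the cubic field of the census row `460944bn1` (`d = -115236`), KERNEL — every cyclotomic `ℤ₂`-extension of `ℚ(θ)`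
has `μ = 0` (growth form).** The `hμ`-core of `conjA_two_460944bn1 hLim2` exposed by name: `n₀ = 0` (kernel) + the capitulation certificate
`classNumberPExp_one_eq_zero_layer_d115236n` (`e₁ = e₀`) + Fukuda 1994 Thm. 1 (1); NO Lim fact, no displayed datum. Input of cruxlead-19573-w2's ℓ = 2 ascent to `ℚ(E[2])`
(Δ < 0). [cite: Fukuda1994, Thm. 1 (1), p. 264] [cite: Greenberg2001IwasawaPastPresent, §4 (Iwasawa's μ-conjecture)] -/
theorem classicalMu_two_460944bn1 {θ : AlgebraicClosure ℚ} (hθ : aeval θ (Cubic.toPoly ⟨1, ((-3 : ℤ) : ℚ), ((0 : ℤ) : ℚ), ((-194 : ℤ) : ℚ)⟩) = 0) :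
    haveI : FiniteDimensional ℚ (IntermediateField.adjoin ℚ {θ}) :=
      IntermediateField.adjoin.finiteDimensional ((AlgebraicClosure.isAlgebraic ℚ).isAlgebraic θ).isIntegral
    haveI : NumberField (IntermediateField.adjoin ℚ {θ}) := NumberField.mk
    ∀ κL : ZpExtension (IntermediateField.adjoin ℚ {θ}) 2, κL.IsCyclotomic → ClassicalMuVanishes κL := by
  haveI : FiniteDimensional ℚ (IntermediateField.adjoin ℚ {θ}) :=
    IntermediateField.adjoin.finiteDimensional ((AlgebraicClosure.isAlgebraic ℚ).isAlgebraic θ).isIntegral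
  haveI : NumberField (IntermediateField.adjoin ℚ {θ}) := NumberField.mk
  intro κL hκL
  have hirr := irreducible_cubic_d115236n
  obtain ⟨B, -, hB⟩ := exists_ringOfIntegers_cubic_root (p := -3) (q := 0) (r := -194) hθ
  have h3 := finrank_adjoin_eq_three_of_irreducible hirr hθ
  have hz : (2 : 𝓞 (IntermediateField.adjoin ℚ {θ})) - (((260397 : ℤ) : 𝓞 (IntermediateField.adjoin ℚ {θ})) + ((50733 : ℤ) : 𝓞 (IntermediateField.adjoin ℚ {θ})) * B + ((10116 : ℤ) : 𝓞 (IntermediateField.adjoin ℚ {θ})) * B ^ 2) ^ 3 =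
      ((-362109567300581077 : ℤ) : 𝓞 (IntermediateField.adjoin ℚ {θ})) + (-51854484649185207 : ℤ) * B + (-13019093978830686 : ℤ) * B ^ 2 := by
    push_cast; linear_combination (((-1775530580943249 : ℤ) : 𝓞 (IntermediateField.adjoin ℚ {θ})) + ((-214094785049964 : ℤ) : 𝓞 (IntermediateField.adjoin ℚ {θ})) * B + ((-18680665392432 : ℤ) : 𝓞 (IntermediateField.adjoin ℚ {θ})) * B ^ 2 + ((-1035205240896 : ℤ) : 𝓞 (IntermediateField.adjoin ℚ {θ})) * B ^ 3) * hB
  have hN : ¬ (8 : ℤ) ∣ Algebra.norm ℤ ((2 : 𝓞 (IntermediateField.adjoin ℚ {θ})) - (((260397 : ℤ) : 𝓞 (IntermediateField.adjoin ℚ {θ})) + ((50733 : ℤ) : 𝓞 (IntermediateField.adjoin ℚ {θ})) * B + ((10116 : ℤ) : 𝓞 (IntermediateField.adjoin ℚ {θ})) * B ^ 2) ^ 3) := by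
    rw [hz]
    exact not_eight_dvd_norm_coords _ h3 B hirr hB (-362109567300581077) (-51854484649185207) (-13019093978830686) (N := -110665217694897703746619984033104565923629875678)
      (by simp only [Matrix.one_fin_three, Matrix.det_fin_three, Matrix.add_apply, Matrix.smul_apply, sq, Matrix.mul_apply,
        Fin.sum_univ_three, Matrix.of_apply, Matrix.cons_val', Matrix.cons_val_zero, Matrix.cons_val_one, Matrix.cons_val_two,
        Matrix.head_cons, Matrix.tail_cons, Matrix.empty_val', Matrix.cons_val_fin_one, smul_eq_mul]; norm_num) (by norm_num)
  exact classicalMuVanishes_of_classNumberPExp_succ_eq fukuda1994_thm1_classNumberPExp_const_of_succ_eq_holds κL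
    ((forall_totallyRamifiedFrom_zero_adjoin_of_evenIndexCertificate (p := -3) (q := 0) (r := -194) hirr hθ
      (((-2 : ℤ) : 𝓞 (IntermediateField.adjoin ℚ {θ})) + ((-2 : ℤ) : 𝓞 (IntermediateField.adjoin ℚ {θ})) * B + ((0 : ℤ) : 𝓞 (IntermediateField.adjoin ℚ {θ})) * B ^ 2) (((0 : ℤ) : 𝓞 (IntermediateField.adjoin ℚ {θ})) + ((-1 : ℤ) : 𝓞 (IntermediateField.adjoin ℚ {θ})) * B + ((-1 : ℤ) : 𝓞 (IntermediateField.adjoin ℚ {θ})) * B ^ 2) (((-484 : ℤ) : 𝓞 (IntermediateField.adjoin ℚ {θ})) + ((-95 : ℤ) : 𝓞 (IntermediateField.adjoin ℚ {θ})) * B + ((-7 : ℤ) : 𝓞 (IntermediateField.adjoin ℚ {θ})) * B ^ 2) (((260397 : ℤ) : 𝓞 (IntermediateField.adjoin ℚ {θ})) + ((50733 : ℤ) : 𝓞 (IntermediateField.adjoin ℚ {θ})) * B + ((10116 : ℤ) : 𝓞 (IntermediateField.adjoin ℚ {θ})) * B ^ 2)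
      (by push_cast; linear_combination (((-10 : ℤ) : 𝓞 (IntermediateField.adjoin ℚ {θ})) + ((-2 : ℤ) : 𝓞 (IntermediateField.adjoin ℚ {θ})) * B) * hB) (by push_cast; linear_combination (((1477 : ℤ) : 𝓞 (IntermediateField.adjoin ℚ {θ})) + ((49 : ℤ) : 𝓞 (IntermediateField.adjoin ℚ {θ})) * B) * hB) hN) κL hκL) le_rfl (classNumberPExp_one_eq_zero_layer_d115236n hθ κL hκL)

end Summit.BirchSwinnertonDyer.BirchSwinnertonDyer.Theorems.AddKatoTwo

end
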